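import Mathlib.NumberTheory.ModularForms.CongruenceSubgroups
import Mathlib.Tactic
import HarnessLib

/-!
# Crux `ThetaLayerLambdaCongruenceAtTwo` (stmt-BirchSwinnertonDyer-20688, route ResidualThetaTransportAtTwo), line
# `birth`, plan step (P3) for the stub (C3): BOUNDARY Manin functions at an odd level are killed by `T₂` modulo `2`
# (width seat bsd-wall-rtt-p3-w3 g2; `--supports stmt-BirchSwinnertonDyer-20688 --as helper`; closes nothing)

HONEST FRAMING. Pure elementary number theory (explicit elements of `Γ₀(N)`) and one cancellation in characteristic `2`;
nothing about any curve or form is asserted; BSD is not proved by any of this.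

WHAT. In the currency of (C3) (`Lines/birth.lean`, functions `Φ : ℚ → k` with Manin's relation), the BOUNDARY
(Eisenstein) Manin functions are the `Γ₀(N)`-INVARIANT ones, `Φ(γ·r) = Φ(r)`. Lead rtt-p3 g2's plan
(`Lines/birth-C3-plan.md`, P3, KEY LEMMA): «on `ℤ[cusps of Γ₀(N')]` (`N'` odd) the operator `T₂` is a PERMUTATION modulo
`2`; hence any Manin function `Φ̄` with `T₂Φ̄ = 0` vanishes on the boundary». This file proves the boundary half in the
function currency, with no cusp classification: for `N` odd, `2 = 0` in `k`, `Φ` `Γ₀(N)`-invariant and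
`(T₂Φ)(r) = Φ(r/2) + Φ((r+1)/2) + Φ(2r) = 0` for all `r` ⟹ `Φ = 0` (`invariantManin_eq_zero_of_heckeTwo`). MECHANISM:
for `s = b/d` with `d` odd, the two points `(2s+1)/2 = (2b+d)/(2d)` and `4s = 4b/d` are `Γ₀(N)`-equivalent; for `d`
even, `s/4 = b/(4d)` and `(s+2)/4 = (b+2d)/(4d)` are — in both cases by an EXPLICIT `γ = g₂ Tⁿ g₁⁻¹ ∈ Γ₀(N)`
(§1, `exists_gamma0_moebius_eq`; `n` exists because `2` is invertible mod `N`); so `T₂Φ` evaluated at `2s` resp. `s/2`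
reads `Φ(s) + 2Φ(·) = Φ(s)`. (The elliptic-point half of P3 and the rest of the (C3) programme are untouched.)

References: [Manin1972] §1.5–1.7 (Manin symbols, cusps of Γ₀(N)); [CremonaAlgorithms1997] Prop. 2.2.3 (cusp equivalence);
[Merel1994] §1.2 (Hecke operators on Manin symbols, `T₂`).
-/

-- justification: the `Summit.BirchSwinnertonDyer.BirchSwinnertonDyer.…` path repeats a component (route-file convention)
set_option linter.dupNamespace false

open scoped MatrixGroups

open CongruenceSubgroup

namespace Summit.BirchSwinnertonDyer.BirchSwinnertonDyer.Theorems.ThetaLayerLambdaCongruenceAtTwo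

/-! ## §1. Cusp transport: an explicit element of `Γ₀(N)` carrying `a₁/c₁` to `a₂/c₂` -/

section Transport

/-- **Cusp transport in `Γ₀(N)`.** Given `a₁d₁ − b₁c₁ = 1`, `a₂d₂ − b₂c₂ = 1`, `c₁, c₂ ≠ 0` and an integer `n` with
`N ∣ c₂d₁ − c₁d₂ − n c₁c₂`, the matrix `γ = g₂ Tⁿ g₁⁻¹` (`g_i = (a_i b_i; c_i d_i)`, `T = (1 1; 0 1)`) lies in `Γ₀(N)` and
its Möbius transformation sends `a₁/c₁` to `a₂/c₂` (with non-vanishing denominator). [cite: CremonaAlgorithms1997, Prop. 2.2.3] -/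
theorem exists_gamma0_moebius_eq (N : ℕ) {a₁ b₁ c₁ d₁ a₂ b₂ c₂ d₂ n : ℤ} (h₁ : a₁ * d₁ - b₁ * c₁ = 1)
    (h₂ : a₂ * d₂ - b₂ * c₂ = 1) (hc₁ : c₁ ≠ 0) (hc₂ : c₂ ≠ 0) (hN : (N : ℤ) ∣ c₂ * d₁ - c₁ * d₂ - n * c₁ * c₂) :
    ∃ γ : CongruenceSubgroup.Gamma0 N,
      ((γ : SL(2, ℤ)) 1 0 : ℚ) * ((a₁ : ℚ) / c₁) + ((γ : SL(2, ℤ)) 1 1 : ℚ) ≠ 0 ∧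
      ((((γ : SL(2, ℤ)) 0 0 : ℚ) * ((a₁ : ℚ) / c₁) + ((γ : SL(2, ℤ)) 0 1 : ℚ)) /
        (((γ : SL(2, ℤ)) 1 0 : ℚ) * ((a₁ : ℚ) / c₁) + ((γ : SL(2, ℤ)) 1 1 : ℚ))) = (a₂ : ℚ) / c₂ := by
  -- the matrix `g₂ Tⁿ g₁⁻¹`
  let M : Matrix (Fin 2) (Fin 2) ℤ :=
    !![a₂ * (d₁ - n * c₁) - b₂ * c₁, a₂ * (n * a₁ - b₁) + b₂ * a₁;
       c₂ * (d₁ - n * c₁) - d₂ * c₁, c₂ * (n * a₁ - b₁) + d₂ * a₁]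
  have hdet : M.det = 1 := by
    rw [Matrix.det_fin_two_of]
    linear_combination (a₂ * d₂ - b₂ * c₂) * h₁ + h₂
  let A : SL(2, ℤ) := ⟨M, hdet⟩
  have hA10 : (A : Matrix (Fin 2) (Fin 2) ℤ) 1 0 = c₂ * (d₁ - n * c₁) - d₂ * c₁ := rfl
  have hmem : A ∈ CongruenceSubgroup.Gamma0 N := by
    rw [Gamma0_mem, hA10, ZMod.intCast_zmod_eq_zero_iff_dvd]
    have e : c₂ * (d₁ - n * c₁) - d₂ * c₁ = c₂ * d₁ - c₁ * d₂ - n * c₁ * c₂ := by ring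
    rw [e]
    exact hN
  have e00 : (A 0 0 : ℤ) = a₂ * (d₁ - n * c₁) - b₂ * c₁ := rfl
  have e01 : (A 0 1 : ℤ) = a₂ * (n * a₁ - b₁) + b₂ * a₁ := rfl
  have e10 : (A 1 0 : ℤ) = c₂ * (d₁ - n * c₁) - d₂ * c₁ := rfl
  have e11 : (A 1 1 : ℤ) = c₂ * (n * a₁ - b₁) + d₂ * a₁ := rfl
  have hc₁' : (c₁ : ℚ) ≠ 0 := by exact_mod_cast hc₁
  have hc₂' : (c₂ : ℚ) ≠ 0 := by exact_mod_cast hc₂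
  have h₁' : (a₁ : ℚ) * d₁ - b₁ * c₁ = 1 := by exact_mod_cast h₁
  have hden : ((A 1 0 : ℤ) : ℚ) * ((a₁ : ℚ) / c₁) + ((A 1 1 : ℤ) : ℚ) = (c₂ : ℚ) / c₁ := by
    rw [e10, e11]
    push_cast
    field_simp
    linear_combination (c₂ : ℚ) * h₁'
  have hnum : ((A 0 0 : ℤ) : ℚ) * ((a₁ : ℚ) / c₁) + ((A 0 1 : ℤ) : ℚ) = (a₂ : ℚ) / c₁ := by
    rw [e00, e01]
    push_cast
    field_simp
    linear_combination (a₂ : ℚ) * h₁'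
  refine ⟨⟨A, hmem⟩, ?_, ?_⟩
  · show ((A 1 0 : ℤ) : ℚ) * ((a₁ : ℚ) / c₁) + ((A 1 1 : ℤ) : ℚ) ≠ 0
    rw [hden]
    exact div_ne_zero hc₂' hc₁'
  · show ((((A 0 0 : ℤ) : ℚ) * ((a₁ : ℚ) / c₁) + ((A 0 1 : ℤ) : ℚ)) /
        (((A 1 0 : ℤ) : ℚ) * ((a₁ : ℚ) / c₁) + ((A 1 1 : ℤ) : ℚ))) = (a₂ : ℚ) / c₂
    rw [hden, hnum, div_div_div_cancel_right₀ hc₁']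

end Transport

/-! ## §2. The two equivalences used by `T₂`: `4s ~ (2s+1)/2` (odd denominator), `s/4 ~ (s+2)/4` (even denominator) -/

section Pairs

/-- `2` is invertible modulo an odd `N`: `∃ x y, 2x + N y = 1`. [folklore] -/
theorem exists_two_mul_add_mul_eq_one_of_odd {N : ℕ} (hN : Odd N) : ∃ x y : ℤ, 2 * x + (N : ℤ) * y = 1 := by
  obtain ⟨m, hm⟩ := hN
  exact ⟨-(m : ℤ), 1, by push_cast [hm]; ring⟩

/-- **Odd denominator**: for `b/d` in lowest terms with `d` odd and `N` odd, some `γ ∈ Γ₀(N)` sends `4b/d` to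
`(2b+d)/(2d)` (`= (2s+1)/2` for `s = b/d`). [cite: CremonaAlgorithms1997, Prop. 2.2.3] -/
theorem exists_gamma0_moebius_odd_den {N : ℕ} (hN : Odd N) {b d : ℤ} (hd : d ≠ 0) (hdodd : Odd d)
    (hbd : IsCoprime b d) :
    ∃ γ : CongruenceSubgroup.Gamma0 N,
      ((γ : SL(2, ℤ)) 1 0 : ℚ) * (((4 * b : ℤ) : ℚ) / d) + ((γ : SL(2, ℤ)) 1 1 : ℚ) ≠ 0 ∧
      ((((γ : SL(2, ℤ)) 0 0 : ℚ) * (((4 * b : ℤ) : ℚ) / d) + ((γ : SL(2, ℤ)) 0 1 : ℚ)) /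
        (((γ : SL(2, ℤ)) 1 0 : ℚ) * (((4 * b : ℤ) : ℚ) / d) + ((γ : SL(2, ℤ)) 1 1 : ℚ))) =
          ((2 * b + d : ℤ) : ℚ) / ((2 * d : ℤ) : ℚ) := by
  obtain ⟨m, hm⟩ := hdodd
  have h2d : IsCoprime (2 : ℤ) d := ⟨-m, 1, by rw [hm]; ring⟩
  -- Bézout data for `4b/d` and `(2b+d)/(2d)`
  have h4 : IsCoprime (4 * b) d := by
    have h44 : IsCoprime (4 : ℤ) d := by
      have := h2d.mul_left h2d
      norm_num at this
      exact this
    exact h44.mul_left hbd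
  obtain ⟨d₁, v₁, hv₁⟩ := h4
  have h2bd : IsCoprime (2 * b + d) (2 * d) := by
    refine IsCoprime.mul_right ⟨1, -(b + m), by rw [hm]; ring⟩ ?_
    have := (h2d.mul_left hbd).add_mul_left_left 1
    rwa [mul_one] at this
  obtain ⟨d₂, v₂, hv₂⟩ := h2bd
  -- `d ∣ 2d₁ − d₂`
  have hdiv : d ∣ 2 * d₁ - d₂ := by
    have e : (2 * d₁ - d₂) * (2 * b) = d * (-v₁ + 2 * v₂ + d₂) := by linear_combination hv₁ - hv₂
    exact (h2d.mul_left hbd).symm.dvd_of_dvd_mul_right ⟨_, e⟩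
  obtain ⟨q, hq⟩ := hdiv
  obtain ⟨x, y, hxy⟩ := exists_two_mul_add_mul_eq_one_of_odd hN
  refine exists_gamma0_moebius_eq N (a₁ := 4 * b) (b₁ := -v₁) (c₁ := d) (d₁ := d₁) (a₂ := 2 * b + d)
    (b₂ := -v₂) (c₂ := 2 * d) (d₂ := d₂) (n := q * x) (by linear_combination hv₁) (by linear_combination hv₂) hd
    (mul_ne_zero two_ne_zero hd) ⟨d * d * q * y, ?_⟩
  linear_combination d * hq - d * d * q * hxy

/-- **Even denominator**: for `b/d` in lowest terms with `b` odd (e.g. `d` even) and `N` odd, some `γ ∈ Γ₀(N)` sends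
`b/(4d)` to `(b+2d)/(4d)` (`= (s+2)/4` for `s = b/d`). [cite: CremonaAlgorithms1997, Prop. 2.2.3] -/
theorem exists_gamma0_moebius_even_den {N : ℕ} (hN : Odd N) {b d : ℤ} (hd : d ≠ 0) (hbodd : Odd b)
    (hbd : IsCoprime b d) :
    ∃ γ : CongruenceSubgroup.Gamma0 N,
      ((γ : SL(2, ℤ)) 1 0 : ℚ) * ((b : ℚ) / ((4 * d : ℤ) : ℚ)) + ((γ : SL(2, ℤ)) 1 1 : ℚ) ≠ 0 ∧
      ((((γ : SL(2, ℤ)) 0 0 : ℚ) * ((b : ℚ) / ((4 * d : ℤ) : ℚ)) + ((γ : SL(2, ℤ)) 0 1 : ℚ)) /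
        (((γ : SL(2, ℤ)) 1 0 : ℚ) * ((b : ℚ) / ((4 * d : ℤ) : ℚ)) + ((γ : SL(2, ℤ)) 1 1 : ℚ))) =
          ((b + 2 * d : ℤ) : ℚ) / ((4 * d : ℤ) : ℚ) := by
  obtain ⟨m, hm⟩ := hbodd
  have hb2 : IsCoprime b (2 : ℤ) := ⟨1, -m, by rw [hm]; ring⟩
  have hb4 : IsCoprime b (4 : ℤ) := by
    have := hb2.mul_right hb2
    norm_num at this
    exact this
  obtain ⟨d₁, v₁, hv₁⟩ := hb4.mul_right hbd
  have hs2 : IsCoprime (b + 2 * d) (2 : ℤ) := ⟨1, -(m + d), by rw [hm]; ring⟩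
  have hs4 : IsCoprime (b + 2 * d) (4 : ℤ) := by
    have := hs2.mul_right hs2
    norm_num at this
    exact this
  have hsd : IsCoprime (b + 2 * d) d := by
    have := hbd.add_mul_left_left 2
    rwa [mul_comm] at this
  obtain ⟨d₂, v₂, hv₂⟩ := hs4.mul_right hsd
  -- `2d ∣ d₁ − d₂`
  have hdiv : 2 * d ∣ d₁ - d₂ := by
    have e : (d₁ - d₂) * b = (2 * d) * (-2 * v₁ + 2 * v₂ + d₂) := by linear_combination hv₁ - hv₂
    exact (hb2.mul_right hbd).symm.dvd_of_dvd_mul_right ⟨_, e⟩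
  obtain ⟨q, hq⟩ := hdiv
  obtain ⟨x, y, hxy⟩ := exists_two_mul_add_mul_eq_one_of_odd hN
  have h4d : (4 * d : ℤ) ≠ 0 := mul_ne_zero (by norm_num) hd
  refine exists_gamma0_moebius_eq N (a₁ := b) (b₁ := -v₁) (c₁ := 4 * d) (d₁ := d₁) (a₂ := b + 2 * d)
    (b₂ := -v₂) (c₂ := 4 * d) (d₂ := d₂) (n := q * x) (by linear_combination hv₁) (by linear_combination hv₂) h4d h4d
    ⟨8 * d * d * q * y, ?_⟩
  linear_combination 4 * d * hq - 8 * d * d * q * hxy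

end Pairs

/-! ## §3. Invariant (boundary) Manin functions with `T₂Φ = 0` vanish, modulo `2` -/

section Boundary

/-- **BOUNDARY Manin functions at odd level are killed by `T₂` modulo `2`.** Let `N` be odd, `k` an additive group
in which `x + x = 0`, and `Φ : ℚ → k` a `Γ₀(N)`-INVARIANT function (`Φ(γ·r) = Φ(r)` whenever `γ·r` is finite — the
boundary/Eisenstein Manin functions of (C3)) with `(T₂Φ)(r) = Φ(r/2) + Φ((r+1)/2) + Φ(2r) = 0` for every `r`. Then
`Φ = 0`: for `s` with odd denominator evaluate `T₂Φ` at `2s` (the other two points are `Γ₀(N)`-equivalent, §2), for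
even denominator at `s/2`. This is the boundary half of P3 of the lead's (C3) plan («`T₂` is a permutation mod `2` on
the cusps of `Γ₀(N')`»). [cite: Merel1994, §1.2 (Hecke operators on Manin symbols; shape)] -/
theorem invariantManin_eq_zero_of_heckeTwo {k : Type*} [AddCommGroup k] (h2 : ∀ x : k, x + x = 0) {N : ℕ}
    (hN : Odd N) (Φ : ℚ → k)
    (hinv : ∀ (γ : CongruenceSubgroup.Gamma0 N) (r : ℚ), ((γ : SL(2, ℤ)) 1 0 : ℚ) * r + ((γ : SL(2, ℤ)) 1 1 : ℚ) ≠ 0 →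
      Φ ((((γ : SL(2, ℤ)) 0 0 : ℚ) * r + ((γ : SL(2, ℤ)) 0 1 : ℚ)) / (((γ : SL(2, ℤ)) 1 0 : ℚ) * r + ((γ : SL(2, ℤ)) 1 1 : ℚ))) = Φ r)
    (hT : ∀ r : ℚ, Φ (r / 2) + Φ ((r + 1) / 2) + Φ (2 * r) = 0) (s : ℚ) : Φ s = 0 := by
  have hs : (s.num : ℚ) / (s.den : ℚ) = s := Rat.num_div_den s
  have hd0 : (s.den : ℤ) ≠ 0 := by exact_mod_cast s.den_nz
  have hd0' : (s.den : ℚ) ≠ 0 := by exact_mod_cast s.den_nz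
  have hbd : IsCoprime s.num (s.den : ℤ) := by
    rw [Int.isCoprime_iff_gcd_eq_one, Int.gcd_eq_natAbs, Int.natAbs_natCast]
    exact s.reduced
  rcases Nat.even_or_odd s.den with hev | hodd
  · -- even denominator: `b` is odd; evaluate `T₂Φ` at `s/2`
    have hbodd : Odd s.num := by
      have hcop : Nat.Coprime s.num.natAbs s.den := s.reduced
      rw [← Int.natAbs_odd, ← Nat.not_even_iff_odd]
      intro hb
      have h2 : 2 ∣ Nat.gcd s.num.natAbs s.den := Nat.dvd_gcd (even_iff_two_dvd.mp hb) (even_iff_two_dvd.mp hev)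
      rw [hcop] at h2
      exact absurd h2 (by norm_num)
    obtain ⟨γ, hne, hγ⟩ := exists_gamma0_moebius_even_den hN hd0 hbodd hbd
    have key := hT (s / 2)
    have e1 : s / 2 / 2 = (s.num : ℚ) / ((4 * (s.den : ℤ) : ℤ) : ℚ) := by
      conv_lhs => rw [← hs]
      push_cast; field_simp; ring
    have e2 : (s / 2 + 1) / 2 = ((s.num + 2 * (s.den : ℤ) : ℤ) : ℚ) / ((4 * (s.den : ℤ) : ℤ) : ℚ) := by
      conv_lhs => rw [← hs]
      push_cast; field_simp; ring
    have e3 : 2 * (s / 2) = s := by ring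
    have hmove := hinv γ _ hne
    rw [hγ] at hmove
    rw [e1, e2, e3, hmove, h2, zero_add] at key
    exact key
  · -- odd denominator: evaluate `T₂Φ` at `2s`
    have hdodd : Odd (s.den : ℤ) := by exact_mod_cast hodd
    obtain ⟨γ, hne, hγ⟩ := exists_gamma0_moebius_odd_den hN hd0 hdodd hbd
    have key := hT (2 * s)
    have e1 : 2 * s / 2 = s := by ring
    have e2 : (2 * s + 1) / 2 = ((2 * s.num + (s.den : ℤ) : ℤ) : ℚ) / ((2 * (s.den : ℤ) : ℤ) : ℚ) := by
      conv_lhs => rw [← hs]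
      push_cast; field_simp
    have e3 : 2 * (2 * s) = ((4 * s.num : ℤ) : ℚ) / ((s.den : ℤ) : ℚ) := by
      conv_lhs => rw [← hs]
      push_cast; ring
    have hmove := hinv γ _ hne
    rw [hγ] at hmove
    rw [e1, e2, e3, hmove, add_assoc, h2, add_zero] at key
    exact key

end Boundary

end Summit.BirchSwinnertonDyer.BirchSwinnertonDyer.Theorems.ThetaLayerLambdaCongruenceAtTwo
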